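import Literature.IUT.HodgeArakelov.BadPrimeGaussianMonoidsCor36GenuineRecordProofs
import Literature.IUT.HodgeArakelov.BadPrimeGaussianMonoidsUnitsSaturationOfTower

/-!
# [IUTchII] Cor 3.6 (ii) «↷» END-TO-END AT THE GENUINE RECORD over `Π = Π^tp_X̲̲` with PRINT'S constant monoid
# `O := 𝒪^▷_{ℚ̄_p} ≤ ℚ̄_pˣ` through `ε`, `Ψ`-level: the model-data inputs `hO` (`Π`-stability) and `hq` (the kernel of the
# augmentation acts trivially) DISCHARGED — proof companion

Proof-only companion (abc-iut cell, layer L6, seat abc-iut-w5-d192 gen 3; node **IUTchII:Cor3.6(ii)** «↷», sub-DAG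
`plan/L6/SUBDAG-IUTchII-Cor-36.md` row Cor-36.ii.r9) to this seat's `BadPrimeGaussianMonoidsCor36GenuineRecordProofs.lean` (p430555:
`EtaleLevels.cor36ii_psi_thetaEnvRecordKummer_of_mem_thetaEnv` — the Frobenioid-theoretic copy of `Ψ_ξ(θ)` at the genuine record is
stable under the labelwise `G_v`-action through the evaluation sections, for ANY `Π^tp_X̲̲`-stable constant monoid `O ≤ A` and any
augmentation `q` whose kernel acts trivially on `O`). HERE `A := ℚ̄_pˣ` with the action through `ε` (abc-iut-w4-d007
`EtaleThetaDataOfSetting.unitsAction`), `O := 𝒪^▷_{ℚ̄_p}` pulled back to `ℚ̄_pˣ` (abc-iut-L4 `nonzeroIntegers`), and `q := ε` itself: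
`hO` is this seat's `EtaleThetaDataOfSetting.smul_mem_comap_nonzeroIntegers_padic` (p429119; abc-iut-L4 `smul_mem_nonzeroIntegers`) and
`hq` is definitional (`units_coe_smul`: `g • u = ε(g)(u)`, so `ε(g) = 1 ⇒ g • u = u`). No definitions.

S. Mochizuki, *Inter-universal Teichmüller theory II*, kurims Dec-2020 manuscript, Cor 3.6 (ii) p. 100 l. 23–26 («each monoid
`Ψ_{Fξ}(†F_v)` is equipped with a natural action by `G_v(M^Θ_*▶)_{⟨F_l^⋇⟩}`»), Prop 3.1 (ii) p. 88 (`Ψ_cns ≅ O^▷_{F̄_v}`)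
[cite: Mochizuki2012, Cor 3.6 (ii) p.100]; [cite: MochizukiAbsTopIII2015, Definition 3.1 (i) p.66] (`𝒪^▷_{k̄}`). Claim key DISPUTED
(D-0012); nothing here takes a side on [IUTchIII] Cor 3.12; typed ≠ proved ≠ endorsed.

PROVED: `EtaleThetaDataOfSetting.smul_eq_self_of_aug_eq_one` (`ε(g) = 1 ⇒ g • u = u` on `ℚ̄_pˣ`),
**`EtaleLevels.cor36ii_psi_thetaEnvRecordKummer_nonzeroIntegers_of_mem_thetaEnv`** — inputs = the evaluation-sections DATA
only (`s_t` continuous into `Π^tp_{Ÿ̲̲}` with common coefficient action `φ₀`, SECTIONS of `ε` up to one identification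
`w : Π₀ → G_{ℚ_p}`, restrictions `R_t` pinned), a class `θ ∈ θ^{i₀}_env(𝕄_*)`, the coefficient datum `c` of the record and
abc-iut-w4-d030/d043's model data; residual for the `∞`-level = the sequel file (olean-gated).
-/

noncomputable section

namespace Literature.IUT.HodgeArakelov

open Literature.AnabelianGeometry.EtaleTheta CohomologySystemOfContH1 EtaleThetaDataOfSetting
open Literature.AnabelianGeometry.AbsoluteAnabelian TemperedThetaMonoids BadPrimeGaussianMonoids

namespace EtaleThetaDataOfSetting

variable {p : ℕ} [Fact p.Prime] {D : Literature.AnabelianGeometry.EtaleTheta.ThetaSetting p}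
  {E : D.EtaleThetaData} {l : ℕ} (C : E.DoubleUnderline l)

/-- **`hq` at the model for `q := ε`**: an element of `Π^tp_X̲̲` with trivial image in `G_{ℚ_p}` acts trivially on `ℚ̄_pˣ`
(the action IS the action through `ε`, abc-iut-w4-d007 `units_coe_smul`). [cite: Mochizuki2012, Prop 3.1 (ii) p.88] -/
theorem smul_eq_self_of_aug_eq_one {g : Pi C} (hg : aug C g = 1) (u : (PadicAlgCl p)ˣ) : g • u = u :=
  Units.ext (by rw [units_coe_smul, hg]; rfl)

end EtaleThetaDataOfSetting

namespace EtaleLevels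

variable {p : ℕ} [Fact p.Prime] {D : Literature.AnabelianGeometry.EtaleTheta.ThetaSetting p}
  {E : D.EtaleThetaData} {l : ℕ} (C : E.DoubleUnderline l) (hC : D.Compat) (hS : D.Sec2Hyps)
  (hl : l.Prime) (hp2 : p ≠ 2) (hpl : p ≠ l) (hζ : ∃ ζ : D.K, IsPrimitiveRoot ζ (4 * l))
  (mods : ∀ M : ℕ+, D.CyclotomeMod l M)
  (f : contCocycles D.toTheta D.DeltaTheta C.GtpYdduu) (hf : f ∈ C.rootCocycles hC)
  (hmods : ∀ (M M' : ℕ+) (h : (M : ℕ) ∣ (M' : ℕ)) (x : D.lDeltaTheta l),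
    MuN.red p M M' h ((mods M').red x) = (mods M).red x)
  (h15 : Literature.AnabelianGeometry.EtaleTheta.ThetaSetting.Prop15iii E hC) (L : C.CuspLabels)
  (hZ : ∀ M : ℕ+, Nonempty (ModelCyclotomes.lDeltaQuot (C.rigidData (mods M) hC hS h15 L) ≃*
    Literature.IUT.HodgeTheaters.ZHat))
  (hcharY : EtaleThetaDataOfSetting.PiYddCharacteristic C)
  (hlim : Function.Bijective (rigidLimHom C hC hS hl hp2 hpl hζ mods f hf hmods h15 L hZ))
  [(EtaleThetaDataOfSetting.PiYdd C).Normal]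
  (c : CyclotomeCoefficients (phi C) (D.lDeltaTheta l) (PadicAlgCl p)ˣ) (ι₀ : Pi C)
  {Lbl : Type*} {P₀ : TopGroup.{0}} (φ₀ : P₀ →* D.GtpTheta) (s : Lbl → (P₀ →* Pi C))
  (hι : ∀ t, Continuous ((MonoidHom.id (Pi C)).comp (s t)))
  (hN : ∀ t, (⊤ : Subgroup P₀).map ((MonoidHom.id (Pi C)).comp (s t)) ≤ PiYdd C)
  (hφ : ∀ t, (phi C).comp ((MonoidHom.id (Pi C)).comp (s t)) = φ₀)

/-- **[IUTchII] Cor 3.6 (ii) «↷», `Ψ`-LEVEL, AT THE GENUINE RECORD with print's constant monoid `O := 𝒪^▷_{ℚ̄_p} ≤ ℚ̄_pˣ`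
through `ε`** (`hO`, `hq` DISCHARGED; `q := ε`): for every family of continuous evaluation sections `s_t : Π₀ → Π^tp_{X̲̲}`
landing in `Π^tp_{Ÿ̲̲}`, with common coefficient action `φ₀`, that are sections of `ε` up to one identification
`w : Π₀ → G_{ℚ_p}` (`ε ∘ s_t = w`), every `θ ∈ θ^{i₀}_env(𝕄_*)` and every tuple `x : Lbl → 𝒪^▷_{ℚ̄_p}` whose labeled Kummer
classes lie in `Ψ_ξ(θ)`: the translated tuple `(s_t(g) · x_t)_t` has its labeled Kummer classes in `Ψ_ξ(θ)` again.
[claim: Mochizuki2012, status: disputed] (IUTchII §3 Cor 3.6 (ii), kurims p.100) -/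
theorem cor36ii_psi_thetaEnvRecordKummer_nonzeroIntegers_of_mem_thetaEnv
    (w : P₀ →* Literature.AnabelianGeometry.SemiGraphs.GQp p)
    (hsec : ∀ t g, aug C (s t g) = w g) {i₀ : Pi C}
    {θ : (thetaEnvRecordKummer C hC hS hl hp2 hpl hζ mods f hf hmods h15 L hZ hcharY hlim c (isOpen_stabilizer_units C)
      (finiteIndex_stabilizer_units C) ((nonzeroIntegers ℚ_[p] (PadicAlgCl p)).comap (Units.coeHom (PadicAlgCl p))) ι₀).H}
    (hθ : θ ∈ (thetaEnvRecordKummer C hC hS hl hp2 hpl hζ mods f hf hmods h15 L hZ hcharY hlim c (isOpen_stabilizer_units C)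
      (finiteIndex_stabilizer_units C) ((nonzeroIntegers ℚ_[p] (PadicAlgCl p)).comap (Units.coeHom (PadicAlgCl p)))
      ι₀).thetaEnv i₀)
    (R : Lbl → ((thetaEnvRecordKummer C hC hS hl hp2 hpl hζ mods f hf hmods h15 L hZ hcharY hlim c (isOpen_stabilizer_units C)
      (finiteIndex_stabilizer_units C) ((nonzeroIntegers ℚ_[p] (PadicAlgCl p)).comap (Units.coeHom (PadicAlgCl p))) ι₀).H →*
      Multiplicative (h1Lim φ₀ (D.lDeltaTheta l) (⊤ : Subgroup P₀) ⊥)))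
    (hR : ∀ t y, Multiplicative.toAdd (R t y) =
      h1LimCongr (D.lDeltaTheta l) ⊤ (hφ t) ⊥
        (h1LimComap (phi C) (D.lDeltaTheta l) ((MonoidHom.id (Pi C)).comp (s t)) (hι t) (hN t)
          (AddEquiv.additiveMultiplicative (h1Lim (phi C) (D.lDeltaTheta l) (PiYdd C) ⊥) (Additive.ofMul y))))
    (t₀ : Lbl) (g : P₀) {x : Lbl → (nonzeroIntegers ℚ_[p] (PadicAlgCl p)).comap (Units.coeHom (PadicAlgCl p))}
    (hx : (fun t => R t (h1LimKummerOn (phi C) (D.lDeltaTheta l) (PiYdd C) c (isOpen_stabilizer_units C)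
        (finiteIndex_stabilizer_units C) ((nonzeroIntegers ℚ_[p] (PadicAlgCl p)).comap (Units.coeHom (PadicAlgCl p))) (x t))) ∈
      MonoidHom.mrange (MonoidHom.pi fun t => (R t).comp (splitMonoid
        (thetaEnvRecordKummer C hC hS hl hp2 hpl hζ mods f hf hmods h15 L hZ hcharY hlim c (isOpen_stabilizer_units C)
          (finiteIndex_stabilizer_units C) ((nonzeroIntegers ℚ_[p] (PadicAlgCl p)).comap (Units.coeHom (PadicAlgCl p)))
          ι₀).units (Submonoid.powers θ)).subtype)) :
    (fun t => R t (h1LimKummerOn (phi C) (D.lDeltaTheta l) (PiYdd C) c (isOpen_stabilizer_units C)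
        (finiteIndex_stabilizer_units C) ((nonzeroIntegers ℚ_[p] (PadicAlgCl p)).comap (Units.coeHom (PadicAlgCl p)))
        ⟨(s t g) • ((x t : (nonzeroIntegers ℚ_[p] (PadicAlgCl p)).comap (Units.coeHom (PadicAlgCl p))) : (PadicAlgCl p)ˣ),
          smul_mem_comap_nonzeroIntegers_padic C (s t g) (x t).2⟩)) ∈
      MonoidHom.mrange (MonoidHom.pi fun t => (R t).comp (splitMonoid
        (thetaEnvRecordKummer C hC hS hl hp2 hpl hζ mods f hf hmods h15 L hZ hcharY hlim c (isOpen_stabilizer_units C)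
          (finiteIndex_stabilizer_units C) ((nonzeroIntegers ℚ_[p] (PadicAlgCl p)).comap (Units.coeHom (PadicAlgCl p)))
          ι₀).units (Submonoid.powers θ)).subtype) :=
  cor36ii_psi_thetaEnvRecordKummer_of_mem_thetaEnv C hC hS hl hp2 hpl hζ mods f hf hmods h15 L hZ hcharY hlim c
    (isOpen_stabilizer_units C) (finiteIndex_stabilizer_units C)
    ((nonzeroIntegers ℚ_[p] (PadicAlgCl p)).comap (Units.coeHom (PadicAlgCl p)))
    (fun σ _ hb => smul_mem_comap_nonzeroIntegers_padic C σ hb) ι₀ φ₀ s hι hN hφ (aug C)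
    (fun _ hy a _ => smul_eq_self_of_aug_eq_one C hy a) w hsec hθ R hR t₀ g hx

end EtaleLevels

end Literature.IUT.HodgeArakelov

end
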